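import Mathlib
import Literature.MathematicalPhysics.QuantumLattice.GermMarkov
import Literature.MathematicalPhysics.QuantumLattice.BallSpecification
import Literature.MathematicalPhysics.QuantumLattice.LatticeScalarField
import Literature.MathematicalPhysics.QuantumLattice.LatticeFieldShellMarkov
import HarnessLib

/-!
# `BallSpecification.BallSpecifiedFieldLimit` — stub `stub_thickShellMarkov` (item stmt-CriticalPhenomena-11247), proved

THEOREM-ONLY file. Registered stub `stub_thickShellMarkov` (S2a) of the line `registered`
(`Cruxes/BallSpecifiedFieldLimit/Lines/birth.lean`): the smeared finite-volume Ising spin field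
`Φ_δ = ρ δ³ ∑_{x ∈ Λ} σ_x δ_{δx}` of `ℤ³` under `μ^{ηbc}_{Λ;β,h}` (boundary condition fixed to `ηbc`
outside `Λ`, any `β`, `h`), at mesh `0 < δ` and field strength `ρ ≠ 0`, is MARKOV ACROSS EVERY
SPHERICAL SHELL THICKER THAN THE MESH: for `δ < ε` the events inside the open ball `B(c, r)` and the
events outside the closed ball `B̄(c, r + ε/2)` are conditionally independent, under the law
`spinFieldLaw μ^{ηbc}_Λ Λ δ ρ` on `𝓢'(ℝ³)`, given the events in the open shell `B(c, r + ε) ∖ B̄(c, r)`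
(`CondIndepCondExp` of `GermMarkov.lean`).

Proof: the case `d = 3` of the Literature theorem
`Literature.MathematicalPhysics.QuantumLattice.condIndepCondExp_shell_spinFieldLaw_isingMeasure`
(`Literature/MathematicalPhysics/QuantumLattice/LatticeFieldShellMarkov.lean`): with
`I = {x ∈ Λ : |δx − c| ≤ r}`, the finite-volume DLR equations of `μ^{ηbc}_Λ` for the sub-volume `I`
(consistency of the Ising kernels) in conditional-expectation form, locality of `η ↦ μ^η_I(A)` in the
boundary spins on `∂ᵉˣI` (radii in `(r, r + δ] ⊆ (r, r + ε)`, spins off `Λ` frozen), isolation of each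
such spin by a Schwartz bump of radius `< δ` supported in the shell, and transport of conditional
expectations along the measurable map `Φ_δ`.
-/

noncomputable section

namespace Summit.CriticalPhenomena.Ising3DConformalLimit.Theorems

open MeasureTheory Literature.MathematicalPhysics.QuantumLattice Literature.Probability.LatticeModels

/-- **Registered stub `stub_thickShellMarkov` (S2a · thick-shell Markov property of lattice fields),
proved**: for the finite-volume Ising measure of `ℤ³` in `Λ` with boundary condition fixed to `ηbc`,
mesh `0 < δ < ε` and field strength `ρ ≠ 0`, the law of the smeared spin field on `𝓢'(ℝ³)` makes the
events in `B(c, r)` and the events outside `B̄(c, r + ε/2)` conditionally independent given the events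
in the shell `B(c, r + ε) ∖ B̄(c, r)`. The case `d = 3` of
`Literature.MathematicalPhysics.QuantumLattice.condIndepCondExp_shell_spinFieldLaw_isingMeasure`
(Friedli–Velenik 2017, eq. (3.26), transported along `Φ_δ`). [cite: FriedliVelenik2017, Exercise 3.11, eq. (3.26)] -/
theorem stub_thickShellMarkov :
    ∀ (Λ : Finset (Literature.Probability.LatticeModels.Site 3)) (β h : ℝ)
      (ηbc : Literature.Probability.LatticeModels.SpinConfig (Literature.Probability.LatticeModels.Site 3)) (δ ρ : ℝ),
      0 < δ → ρ ≠ 0 →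
      ∀ (c : EuclideanSpace ℝ (Fin 3)) (r ε : ℝ), δ < ε →
        Literature.MathematicalPhysics.QuantumLattice.CondIndepCondExp
          (Literature.MathematicalPhysics.QuantumLattice.extEvents (Metric.ball c (r + ε) \ Metric.closedBall c r))
          (Literature.MathematicalPhysics.QuantumLattice.extEvents (Metric.ball c r))
          (Literature.MathematicalPhysics.QuantumLattice.extEvents (Metric.closedBall c (r + ε / 2))ᶜ)
          (Literature.MathematicalPhysics.QuantumLattice.spinFieldLaw (Literature.Probability.LatticeModels.isingMeasure (Literature.Probability.LatticeModels.zdGraph 3) Λ β h (Literature.Probability.LatticeModels.BoundaryCondition.fixed ηbc)) Λ δ ρ) :=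
  fun Λ β h ηbc _ _ hδ hρ c r ε hδε =>
    condIndepCondExp_shell_spinFieldLaw_isingMeasure Λ β h ηbc hδ hρ c r ε hδε

end Summit.CriticalPhenomena.Ising3DConformalLimit.Theorems

end
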